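import Summits.NavierStokesRegularity.NavierStokesRegularity.Theorems.LerayQuarterDissipationFiniteDissipationLiouvilleSliceLSix
import HarnessLib

/-!
# Route `LerayQuarterDissipation`, crux `FiniteDissipationLiouville` (stmt-NavierStokesRegularity-22144)
  — the scaled `L³` quantity is bounded on the finite-dissipation stratum, uniformly in the scale

`--supports stmt-NavierStokesRegularity-22144` (helper). For a member `w` of the finite-dissipation
stratum (Type-I ancient mild field in the KNSS gauge with `∫‖∇w(s)‖² ≤ K/√(−s)`), the slices lie in
`L⁶` with `‖w(t)‖₆ ≤ C_S √(K⁺/√(−t))` (`memLp_six_slice`); Cauchy–Schwarz on the ball and the time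
integral `∫_{−r²}^0 (−t)^{-3/4} dt = 4√r` then give the **scale-invariant Caffarelli–Kohn–Nirenberg
quantity** `C(r) = r⁻² ∬_{Q_r(0,0)} |w|³` a bound INDEPENDENT of `r`:

  `∫_{−r²}^{0} ∫_{B(0,r)} ‖w‖³ ≤ C₃ (K⁺)^{3/2} r²`   (`lintegral_cylinder_cube_le`),

i.e. members of the stratum are in `L³` on every backward cylinder at the apex with the CKN
scaling (the legality of the `ε`-regularity / Albritton–Barker machinery on the stratum invoked by
the route's refuter and disprover; on the bare Type-I class `∫_{Q_r}|w|³` may diverge like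
`∫(−t)^{-3/2}`). Nothing here bears on Navier–Stokes regularity; no summit is proved.
-/

noncomputable section

open Set MeasureTheory Filter Topology Function Metric Real
open Literature.Analysis Literature.Analysis.FluidPDE
open scoped ENNReal NNReal

namespace Summit.NavierStokesRegularity.NavierStokesRegularity.Theorems.FiniteDissipationLiouville.Birth

-- the problem-side namespace duplicates `NavierStokesRegularity` by design (summit = problem)
set_option linter.dupNamespace false

/-- `∫_{(−r², 0)} (−t)^{-3/4} dt = 4 √r` for `r > 0`. -/
theorem integral_Ioo_neg_rpow_threeQuarters {r : ℝ} (hr : 0 < r) :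
    ∫ t in Ioo (-(r ^ 2)) 0, (-t) ^ (-(3 / 4 : ℝ)) = 4 * Real.sqrt r := by
  have hr2 : -(r ^ 2) ≤ 0 := by nlinarith
  rw [← integral_Ioc_eq_integral_Ioo, ← intervalIntegral.integral_of_le hr2]
  have h := intervalIntegral.integral_comp_sub_left (fun x : ℝ => x ^ (-(3 / 4 : ℝ))) (0 : ℝ)
    (a := -(r ^ 2)) (b := 0)
  simp only [zero_sub] at h
  rw [h, neg_zero, neg_neg, integral_rpow (Or.inl (by norm_num))]
  have e3 : (-(3 / 4 : ℝ)) + 1 = 1 / 4 := by norm_num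
  rw [e3, Real.zero_rpow (by norm_num), sub_zero]
  have hq : (r ^ 2) ^ (1 / 4 : ℝ) = Real.sqrt r := by
    rw [Real.sqrt_eq_rpow, ← Real.rpow_natCast, ← Real.rpow_mul hr.le]
    norm_num
  rw [hq]
  ring

/-- The weight `t ↦ (−t)^{-3/4}` is integrable on `(−r², 0)`. -/
theorem integrableOn_Ioo_neg_rpow_threeQuarters (r : ℝ) :
    IntegrableOn (fun t : ℝ => (-t) ^ (-(3 / 4 : ℝ))) (Ioo (-(r ^ 2)) 0) := by
  have hII : IntervalIntegrable (fun x : ℝ => x ^ (-(3 / 4 : ℝ))) volume (0 - -(r ^ 2)) (0 - 0) :=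
    intervalIntegral.intervalIntegrable_rpow' (by norm_num)
  have hc := hII.comp_sub_left 0
  simp only [zero_sub, neg_neg, sub_self] at hc
  rcases le_or_gt (-(r ^ 2)) 0 with h | h
  · exact (intervalIntegrable_iff_integrableOn_Ioo_of_le h).1 hc
  · rw [Ioo_eq_empty (not_lt.2 h.le)]
    exact integrableOn_empty

/-- **The scaled `L³` quantity is bounded on the stratum, uniformly in the scale.** There is an
absolute `C₃ > 0` such that every member `w` of the finite-dissipation stratum satisfies
`∫_{t ∈ (−r², 0)} ∫_{B(0,r)} ‖w(t,x)‖³ dx dt ≤ C₃ (max K 0)^{3/2} r²` for every `r > 0` (lintegral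
form). -/
theorem lintegral_cylinder_cube_le :
    ∃ C₃ : ℝ, 0 < C₃ ∧ ∀ (C K : ℝ)
      (w : ℝ → EuclideanSpace ℝ (Fin 3) → EuclideanSpace ℝ (Fin 3)),
      Literature.Analysis.FluidPDE.IsTypeIAncientMild C w →
      (∀ s : ℝ, s < 0 → ∫⁻ x, ‖fderiv ℝ (w s) x‖ₑ ^ 2 ≤ ENNReal.ofReal (K / Real.sqrt (-s))) →
      ∀ r : ℝ, 0 < r →
        ∫⁻ t in Ioo (-(r ^ 2)) 0, ∫⁻ x in Metric.ball (0 : EuclideanSpace ℝ (Fin 3)) r,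
            ‖w t x‖ₑ ^ (3 : ℝ) ≤
          ENNReal.ofReal (C₃ * (max K 0) ^ (3 / 2 : ℝ) * r ^ 2) := by
  obtain ⟨CL, hCL, hsix⟩ := memLp_six_slice
  -- the unit ball volume
  set V₁ : ℝ≥0∞ := volume (Metric.ball (0 : EuclideanSpace ℝ (Fin 3)) 1) with hV₁
  have hV₁top : V₁ ≠ ⊤ := measure_ball_lt_top.ne
  set v₁ : ℝ := (V₁ ^ (1 / 2 : ℝ)).toReal with hv₁
  have hv₁0 : 0 ≤ v₁ := ENNReal.toReal_nonneg
  refine ⟨4 * CL ^ 3 * v₁ + 1, by positivity, ?_⟩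
  intro C K w hw hD r hr
  set Kp : ℝ := max K 0 with hKp
  have hKp0 : 0 ≤ Kp := le_max_right _ _
  -- per slice: Cauchy–Schwarz on the ball and the `L⁶` bound
  have hslice : ∀ t ∈ Ioo (-(r ^ 2)) (0 : ℝ),
      ∫⁻ x in Metric.ball (0 : EuclideanSpace ℝ (Fin 3)) r, ‖w t x‖ₑ ^ (3 : ℝ) ≤
        ENNReal.ofReal ((CL * Real.sqrt (Kp / Real.sqrt (-t))) ^ 3 * (r ^ 3) ^ (1 / 2 : ℝ)) *
          V₁ ^ (1 / 2 : ℝ) := by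
    intro t ht
    have ht0 : t < 0 := ht.2
    obtain ⟨hmem, hN⟩ := hsix C K w hw hD t ht0
    set μ : Measure (EuclideanSpace ℝ (Fin 3)) :=
      volume.restrict (Metric.ball (0 : EuclideanSpace ℝ (Fin 3)) r) with hμ
    have hmeas : AEMeasurable (fun x => ‖w t x‖ₑ ^ (3 : ℝ)) μ :=
      ((hw.continuous_slice ht0).measurable.enorm.pow_const _).aemeasurable
    have hpq : (2 : ℝ).HolderConjugate 2 := ⟨by norm_num, by norm_num, by norm_num⟩
    have hCS := ENNReal.lintegral_mul_le_Lp_mul_Lq μ hpq hmeas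
      (aemeasurable_const (b := (1 : ℝ≥0∞)))
    have hone : ∫⁻ x, (fun _ => (1 : ℝ≥0∞)) x ^ (2 : ℝ) ∂μ = volume (Metric.ball (0 : EuclideanSpace ℝ (Fin 3)) r) := by
      simp [hμ]
    have hball : volume (Metric.ball (0 : EuclideanSpace ℝ (Fin 3)) r) =
        ENNReal.ofReal (r ^ 3) * V₁ := by
      rw [hV₁, Measure.addHaar_ball_of_pos volume (0 : EuclideanSpace ℝ (Fin 3)) hr,
        finrank_euclideanSpace_fin]
    -- `(∫_ball ‖w‖ₑ^6)^{1/2} ≤ (∫ ‖w‖ₑ^6)^{1/2} = ‖w‖₆³`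
    have hsixpow : (∫⁻ x, (‖w t x‖ₑ ^ (3 : ℝ)) ^ (2 : ℝ) ∂μ) ^ (1 / (2 : ℝ)) ≤
        ENNReal.ofReal ((CL * Real.sqrt (Kp / Real.sqrt (-t))) ^ 3) := by
      have e1 : ∀ x, (‖w t x‖ₑ ^ (3 : ℝ)) ^ (2 : ℝ) = ‖w t x‖ₑ ^ (6 : ℝ) := fun x => by
        rw [← ENNReal.rpow_mul]; norm_num
      simp_rw [e1]
      have hle : ∫⁻ x, ‖w t x‖ₑ ^ (6 : ℝ) ∂μ ≤ ∫⁻ x, ‖w t x‖ₑ ^ (6 : ℝ) := by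
        rw [hμ]; exact setLIntegral_le_lintegral _ _
      have hfull : (∫⁻ x, ‖w t x‖ₑ ^ (6 : ℝ)) ^ (1 / (2 : ℝ)) = (eLpNorm (w t) 6 volume) ^ (3 : ℝ) := by
        rw [eLpNorm_eq_lintegral_rpow_enorm_toReal (by norm_num) (by norm_num), ENNReal.toReal_ofNat,
          ← ENNReal.rpow_mul]
        norm_num
      have hnorm : eLpNorm (w t) 6 volume ≤ ENNReal.ofReal (CL * Real.sqrt (Kp / Real.sqrt (-t))) := by
        rw [hmem.eLpNorm_eq_integral_rpow_norm (by norm_num) (by norm_num)]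
        simp only [ENNReal.toReal_ofNat, one_div] at hN ⊢
        exact ENNReal.ofReal_le_ofReal hN
      calc (∫⁻ x, ‖w t x‖ₑ ^ (6 : ℝ) ∂μ) ^ (1 / (2 : ℝ))
          ≤ (∫⁻ x, ‖w t x‖ₑ ^ (6 : ℝ)) ^ (1 / (2 : ℝ)) := ENNReal.rpow_le_rpow hle (by norm_num)
        _ = (eLpNorm (w t) 6 volume) ^ (3 : ℝ) := hfull
        _ ≤ (ENNReal.ofReal (CL * Real.sqrt (Kp / Real.sqrt (-t)))) ^ (3 : ℝ) :=
            ENNReal.rpow_le_rpow hnorm (by norm_num)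
        _ = ENNReal.ofReal ((CL * Real.sqrt (Kp / Real.sqrt (-t))) ^ 3) := by
            rw [ENNReal.ofReal_rpow_of_nonneg (by positivity) (by norm_num),
              show (3 : ℝ) = ((3 : ℕ) : ℝ) by norm_num, Real.rpow_natCast]
    calc ∫⁻ x in Metric.ball (0 : EuclideanSpace ℝ (Fin 3)) r, ‖w t x‖ₑ ^ (3 : ℝ)
        = ∫⁻ x, (fun x => ‖w t x‖ₑ ^ (3 : ℝ)) x * (fun _ => (1 : ℝ≥0∞)) x ∂μ := by
          simp [hμ]
      _ ≤ (∫⁻ x, (‖w t x‖ₑ ^ (3 : ℝ)) ^ (2 : ℝ) ∂μ) ^ (1 / (2 : ℝ)) *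
            (∫⁻ x, (fun _ => (1 : ℝ≥0∞)) x ^ (2 : ℝ) ∂μ) ^ (1 / (2 : ℝ)) := hCS
      _ ≤ ENNReal.ofReal ((CL * Real.sqrt (Kp / Real.sqrt (-t))) ^ 3) *
            (ENNReal.ofReal (r ^ 3) * V₁) ^ (1 / (2 : ℝ)) := by
          rw [hone, hball]
          exact mul_le_mul' hsixpow le_rfl
      _ = ENNReal.ofReal ((CL * Real.sqrt (Kp / Real.sqrt (-t))) ^ 3 * (r ^ 3) ^ (1 / 2 : ℝ)) *
            V₁ ^ (1 / 2 : ℝ) := by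
          rw [ENNReal.mul_rpow_of_nonneg _ _ (by norm_num : (0 : ℝ) ≤ 1 / 2),
            ENNReal.ofReal_rpow_of_nonneg (by positivity) (by norm_num),
            ENNReal.ofReal_mul (by positivity), mul_assoc]
  -- the time integral
  have hcube : ∀ t ∈ Ioo (-(r ^ 2)) (0 : ℝ),
      (CL * Real.sqrt (Kp / Real.sqrt (-t))) ^ 3 * (r ^ 3) ^ (1 / 2 : ℝ) =
        CL ^ 3 * Kp ^ (3 / 2 : ℝ) * (r ^ 3) ^ (1 / 2 : ℝ) * (-t) ^ (-(3 / 4 : ℝ)) := by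
    intro t ht
    have hnt : 0 < -t := neg_pos.2 ht.2
    have hs : Real.sqrt (Kp / Real.sqrt (-t)) ^ 3 = Kp ^ (3 / 2 : ℝ) * (-t) ^ (-(3 / 4 : ℝ)) := by
      rw [Real.sqrt_eq_rpow, Real.sqrt_eq_rpow, ← Real.rpow_natCast,
        ← Real.rpow_mul (div_nonneg hKp0 (Real.rpow_nonneg hnt.le _)),
        Real.div_rpow hKp0 (Real.rpow_nonneg hnt.le _), ← Real.rpow_mul hnt.le,
        div_eq_mul_inv, ← Real.rpow_neg hnt.le]
      norm_num
    rw [mul_pow, hs]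
    ring
  calc ∫⁻ t in Ioo (-(r ^ 2)) 0, ∫⁻ x in Metric.ball (0 : EuclideanSpace ℝ (Fin 3)) r,
          ‖w t x‖ₑ ^ (3 : ℝ)
      ≤ ∫⁻ t in Ioo (-(r ^ 2)) 0,
          ENNReal.ofReal (CL ^ 3 * Kp ^ (3 / 2 : ℝ) * (r ^ 3) ^ (1 / 2 : ℝ) * (-t) ^ (-(3 / 4 : ℝ))) *
            V₁ ^ (1 / 2 : ℝ) := by
        refine setLIntegral_mono' measurableSet_Ioo fun t ht => ?_
        rw [← hcube t ht]
        exact hslice t ht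
    _ = (∫⁻ t in Ioo (-(r ^ 2)) 0,
          ENNReal.ofReal (CL ^ 3 * Kp ^ (3 / 2 : ℝ) * (r ^ 3) ^ (1 / 2 : ℝ) * (-t) ^ (-(3 / 4 : ℝ)))) *
            V₁ ^ (1 / 2 : ℝ) := by
        rw [lintegral_mul_const _ ?_]
        exact ENNReal.measurable_ofReal.comp (measurable_const.mul
          (measurable_neg.pow_const _))
    _ = ENNReal.ofReal (CL ^ 3 * Kp ^ (3 / 2 : ℝ) * (r ^ 3) ^ (1 / 2 : ℝ) * (4 * Real.sqrt r)) *
            V₁ ^ (1 / 2 : ℝ) := by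
        congr 1
        rw [← ofReal_integral_eq_lintegral_ofReal
          ((integrableOn_Ioo_neg_rpow_threeQuarters r).const_mul _)]
        · rw [integral_const_mul, integral_Ioo_neg_rpow_threeQuarters hr]
        · refine ae_restrict_of_forall_mem measurableSet_Ioo fun t ht => ?_
          exact mul_nonneg (by positivity) (Real.rpow_nonneg (by linarith [ht.2]) _)
    _ = ENNReal.ofReal (4 * CL ^ 3 * v₁ * Kp ^ (3 / 2 : ℝ) * r ^ 2) := by
        have hV : V₁ ^ (1 / 2 : ℝ) = ENNReal.ofReal v₁ := by
          rw [hv₁, ENNReal.ofReal_toReal (ENNReal.rpow_ne_top_of_nonneg (by norm_num) hV₁top)]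
        rw [hV, ← ENNReal.ofReal_mul (by positivity)]
        congr 1
        have hr32 : (r ^ 3) ^ (1 / 2 : ℝ) * Real.sqrt r = r ^ 2 := by
          rw [Real.sqrt_eq_rpow, ← Real.rpow_natCast, ← Real.rpow_mul hr.le,
            ← Real.rpow_add hr]
          norm_num
        calc CL ^ 3 * Kp ^ (3 / 2 : ℝ) * (r ^ 3) ^ (1 / 2 : ℝ) * (4 * Real.sqrt r) * v₁
            = 4 * CL ^ 3 * v₁ * Kp ^ (3 / 2 : ℝ) * ((r ^ 3) ^ (1 / 2 : ℝ) * Real.sqrt r) := by ring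
          _ = 4 * CL ^ 3 * v₁ * Kp ^ (3 / 2 : ℝ) * r ^ 2 := by rw [hr32]
    _ ≤ ENNReal.ofReal ((4 * CL ^ 3 * v₁ + 1) * Kp ^ (3 / 2 : ℝ) * r ^ 2) := by
        refine ENNReal.ofReal_le_ofReal ?_
        have h0 : 0 ≤ Kp ^ (3 / 2 : ℝ) * r ^ 2 := by positivity
        nlinarith [h0]

end Summit.NavierStokesRegularity.NavierStokesRegularity.Theorems.FiniteDissipationLiouville.Birth

end
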